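import Literature.AlgebraicGeometry.Motives.HodgeStructureWeil
import HarnessLib

/-!
# The polarized weight-one Hodge structure of a complex structure with a Riemann form

Classical (Riemann; Mumford, *Abelian Varieties* §1–§2; van Geemen LNM 1594, 3.1 and 5.5–5.7;
Deligne LNM 900, proof of Thm. 4.8, p. 47 (a), (b); Carlson–Müller-Stach–Peters §3.5): a complex
structure `J` (`J² = -1`) on the real vector space `V_ℝ = V ⊗_ℚ ℝ` of a `ℚ`-vector space `V` is
the same as a `ℚ`-Hodge structure of weight one on `V`, `V_ℂ = V^{1,0} ⊕ V^{0,1}`,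
`V^{0,1} = conj V^{1,0}`, the two summands being the `∓i`-eigenspaces of `J_ℂ`; and an alternating
form `E` on `V` is a polarization of it iff it satisfies the RIEMANN RELATIONS `E(Jx, Jy) = E(x, y)`,
`E(x, Jx) > 0` (`x ≠ 0`) (van Geemen 5.6; Deligne (b): "`ψ` is a Riemann form relative to the
complex structure"). This is the linear algebra which, composed with complex uniformisation
`A(ℂ) = V_ℝ/Λ`, identifies Deligne's domain `X⁺` of complex structures with a family of polarized
abelian varieties (LNM 900 pp. 47–49; van Geemen 5.7–5.8).

In the tree's vocabulary (`Motives/HodgeStructure`: `V_ℂ = ℂ ⊗[ℚ] V`, `HodgeStructure.conj`,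
`HodgeStructure V 1`, `Polarization`, untwisted sign `i^{p-q} Q(x, conj x) > 0`;
`Motives/HodgeStructureWeil`: `HodgeStructure.ofSplitting`):

* the real structure of `V_ℂ`: `rePart`, `imPart : V_ℂ → V_ℝ` (`re ⊗ id`, `im ⊗ id`),
  `ofRealT : V_ℝ → V_ℂ`, `mkCx a b = a + ib`, with the calculus of parts (`rePart_smul`, …,
  `mkCx_rePart_imPart`, `baseChange_mkCx_mkCx`);
* `cxF1 J ⊂ V_ℂ`, the `-i`-eigenspace `{a + iJa}` of `J_ℂ` (`V^{1,0}`; with the tree's untwisted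
  positivity convention and `Q = E` it is the `-i`-eigenspace that is of type `(1, 0)`), and
  `isCompl_cxF1 : V_ℂ = cxF1 J ⊕ conj (cxF1 J)`;
* `hodgeStructureOfCx J hJ : HodgeStructure V 1` and its pieces (`piece_one_zero`, `piece_zero_one`,
  `piece_eq_bot`, effectivity, `2 h^{1,0} = dim_ℚ V`);
* `polarizationOfRiemannForm`: an alternating `E` with the Riemann relations for `J` polarizes
  `hodgeStructureOfCx J hJ` (first relation: `V^{1,0}` is `E_ℂ`-isotropic; second:
  `i E_ℂ(x, conj x) = 2E(a, Ja) > 0` for `x = a + iJa`).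

Everything is proved; no named fact is introduced. The Weil-type layer (a `K`-action commuting
with `J`; `Motives/WeilDatumPeriodDomain`) is not in this file.

## References

* [vanGeemen1994HodgeAV] B. van Geemen, LNM 1594 (1994), 3.1, 5.5–5.7.
* [Deligne1982HodgeCycles] P. Deligne, LNM 900 (1982), proof of Thm. 4.8, p. 47 (a), (b).
* [CarlsonMullerStachPeters2017] J. Carlson, S. Müller-Stach, C. Peters, *Period Mappings and
  Period Domains*, 2nd ed., §3.5 eq. (3.5) and §1.2 (weight one Hodge structures = complex tori).
* [MumfordAV] D. Mumford, *Abelian Varieties*, §1–§2 (Riemann form of a complex torus).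
-/

noncomputable section

open Module
open scoped TensorProduct

namespace Literature.AlgebraicGeometry.Motives

namespace HodgeStructure

universe u

variable {V : Type u} [AddCommGroup V] [Module ℚ V]

/-! ### The real structure of `V_ℂ`: real and imaginary parts -/

/-- The real part `re ⊗ id : V_ℂ → V_ℝ`. [folklore] -/
def rePart : ℂ ⊗[ℚ] V →ₗ[ℚ] ℝ ⊗[ℚ] V := (Complex.reLm.restrictScalars ℚ).rTensor V

/-- The imaginary part `im ⊗ id : V_ℂ → V_ℝ`. [folklore] -/
def imPart : ℂ ⊗[ℚ] V →ₗ[ℚ] ℝ ⊗[ℚ] V := (Complex.imLm.restrictScalars ℚ).rTensor V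

/-- The inclusion `V_ℝ ↪ V_ℂ`, `r ⊗ v ↦ r ⊗ v`. [folklore] -/
def ofRealT : ℝ ⊗[ℚ] V →ₗ[ℚ] ℂ ⊗[ℚ] V := (Complex.ofRealAm.toLinearMap.restrictScalars ℚ).rTensor V

/-- `rePart (z ⊗ v) = re z ⊗ v`. [folklore] -/
@[simp]
theorem rePart_tmul (z : ℂ) (v : V) : rePart (z ⊗ₜ[ℚ] v) = z.re ⊗ₜ[ℚ] v := rfl

/-- `imPart (z ⊗ v) = im z ⊗ v`. [folklore] -/
@[simp]
theorem imPart_tmul (z : ℂ) (v : V) : imPart (z ⊗ₜ[ℚ] v) = z.im ⊗ₜ[ℚ] v := rfl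

/-- `ofRealT (r ⊗ v) = (r : ℂ) ⊗ v`. [folklore] -/
@[simp]
theorem ofRealT_tmul (r : ℝ) (v : V) : ofRealT (r ⊗ₜ[ℚ] v) = (r : ℂ) ⊗ₜ[ℚ] v := rfl

/-- `re (a) = a` for real `a`. [folklore] -/
@[simp]
theorem rePart_ofRealT (a : ℝ ⊗[ℚ] V) : rePart (ofRealT a) = a := by
  induction a using TensorProduct.induction_on with
  | zero => simp
  | tmul r v => simp
  | add x y hx hy => rw [map_add, map_add, hx, hy]

/-- `im (a) = 0` for real `a`. [folklore] -/
@[simp]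
theorem imPart_ofRealT (a : ℝ ⊗[ℚ] V) : imPart (ofRealT a) = 0 := by
  induction a using TensorProduct.induction_on with
  | zero => simp
  | tmul r v => simp
  | add x y hx hy => rw [map_add, map_add, hx, hy, add_zero]

/-- `re (z x) = re z · re x - im z · im x`. [folklore] -/
theorem rePart_smul (z : ℂ) (x : ℂ ⊗[ℚ] V) : rePart (z • x) = z.re • rePart x - z.im • imPart x := by
  induction x using TensorProduct.induction_on with
  | zero => simp
  | tmul w v =>
    rw [TensorProduct.smul_tmul', rePart_tmul, rePart_tmul, imPart_tmul, TensorProduct.smul_tmul',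
      TensorProduct.smul_tmul', ← TensorProduct.sub_tmul, smul_eq_mul, Complex.mul_re, smul_eq_mul,
      smul_eq_mul]
  | add x y hx hy => rw [smul_add, map_add, hx, hy, map_add, map_add, smul_add, smul_add]; abel

/-- `im (z x) = re z · im x + im z · re x`. [folklore] -/
theorem imPart_smul (z : ℂ) (x : ℂ ⊗[ℚ] V) : imPart (z • x) = z.re • imPart x + z.im • rePart x := by
  induction x using TensorProduct.induction_on with
  | zero => simp
  | tmul w v =>
    rw [TensorProduct.smul_tmul', imPart_tmul, rePart_tmul, imPart_tmul, TensorProduct.smul_tmul',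
      TensorProduct.smul_tmul', ← TensorProduct.add_tmul, smul_eq_mul, Complex.mul_im, smul_eq_mul,
      smul_eq_mul, add_comm]
  | add x y hx hy => rw [smul_add, map_add, hx, hy, map_add, map_add, smul_add, smul_add]; abel

/-- `re ((r : ℂ) x) = r · re x`. [folklore] -/
theorem rePart_coe_smul (r : ℝ) (x : ℂ ⊗[ℚ] V) : rePart ((r : ℂ) • x) = r • rePart x := by
  rw [rePart_smul]; simp

/-- `im ((r : ℂ) x) = r · im x`. [folklore] -/
theorem imPart_coe_smul (r : ℝ) (x : ℂ ⊗[ℚ] V) : imPart ((r : ℂ) • x) = r • imPart x := by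
  rw [imPart_smul]; simp

/-- `re (i x) = -im x`. [folklore] -/
theorem rePart_I_smul (x : ℂ ⊗[ℚ] V) : rePart (Complex.I • x) = -imPart x := by
  rw [rePart_smul]; simp

/-- `im (i x) = re x`. [folklore] -/
theorem imPart_I_smul (x : ℂ ⊗[ℚ] V) : imPart (Complex.I • x) = rePart x := by
  rw [imPart_smul]; simp

/-- `(r a) = (r : ℂ) a` in `V_ℂ` for real `r`, `a`. [folklore] -/
theorem ofRealT_smul (r : ℝ) (a : ℝ ⊗[ℚ] V) : ofRealT (r • a) = (r : ℂ) • ofRealT a := by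
  induction a using TensorProduct.induction_on with
  | zero => simp
  | tmul s v =>
    rw [TensorProduct.smul_tmul', ofRealT_tmul, ofRealT_tmul, TensorProduct.smul_tmul', smul_eq_mul,
      smul_eq_mul, Complex.ofReal_mul]
  | add x y hx hy => rw [smul_add, map_add, hx, hy, map_add, smul_add]

/-- **`x = re x + i im x`.** [folklore] -/
theorem ofRealT_rePart_add_I_smul_ofRealT_imPart (x : ℂ ⊗[ℚ] V) :
    ofRealT (rePart x) + Complex.I • ofRealT (imPart x) = x := by
  induction x using TensorProduct.induction_on with
  | zero => simp
  | tmul w v =>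
    rw [rePart_tmul, imPart_tmul, ofRealT_tmul, ofRealT_tmul, TensorProduct.smul_tmul',
      ← TensorProduct.add_tmul, smul_eq_mul, mul_comm, Complex.re_add_im]
  | add x y hx hy =>
    rw [map_add, map_add, map_add, map_add, smul_add]
    nth_rewrite 3 [← hx]
    nth_rewrite 3 [← hy]
    abel

/-- A vector of `V_ℂ` is determined by its real and imaginary parts. [folklore] -/
theorem ext_parts {x y : ℂ ⊗[ℚ] V} (h₁ : rePart x = rePart y) (h₂ : imPart x = imPart y) : x = y := by
  rw [← ofRealT_rePart_add_I_smul_ofRealT_imPart x, ← ofRealT_rePart_add_I_smul_ofRealT_imPart y,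
    h₁, h₂]

/-- Complex conjugation fixes the real part. [folklore] -/
@[simp]
theorem rePart_conj (x : ℂ ⊗[ℚ] V) : rePart (conj x) = rePart x := by
  induction x using TensorProduct.induction_on with
  | zero => simp
  | tmul w v => simp
  | add x y hx hy => rw [map_add, map_add, hx, hy, map_add]

/-- Complex conjugation negates the imaginary part. [folklore] -/
@[simp]
theorem imPart_conj (x : ℂ ⊗[ℚ] V) : imPart (conj x) = -imPart x := by
  induction x using TensorProduct.induction_on with
  | zero => simp
  | tmul w v => simp [TensorProduct.neg_tmul]
  | add x y hx hy => rw [map_add, map_add, hx, hy, map_add, neg_add]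

/-- `a + ib ∈ V_ℂ` for `a, b ∈ V_ℝ`. [folklore] -/
def mkCx (a b : ℝ ⊗[ℚ] V) : ℂ ⊗[ℚ] V := ofRealT a + Complex.I • ofRealT b

/-- `re (a + ib) = a`. [folklore] -/
@[simp]
theorem rePart_mkCx (a b : ℝ ⊗[ℚ] V) : rePart (mkCx a b) = a := by
  rw [mkCx, map_add, rePart_ofRealT, rePart_I_smul, imPart_ofRealT, neg_zero, add_zero]

/-- `im (a + ib) = b`. [folklore] -/
@[simp]
theorem imPart_mkCx (a b : ℝ ⊗[ℚ] V) : imPart (mkCx a b) = b := by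
  rw [mkCx, map_add, imPart_ofRealT, imPart_I_smul, rePart_ofRealT, zero_add]

/-- `x = re x + i im x` (in terms of `mkCx`). [folklore] -/
@[simp]
theorem mkCx_rePart_imPart (x : ℂ ⊗[ℚ] V) : mkCx (rePart x) (imPart x) = x :=
  ofRealT_rePart_add_I_smul_ofRealT_imPart x

/-- `conj (a + ib) = a - ib`. [folklore] -/
theorem conj_mkCx (a b : ℝ ⊗[ℚ] V) : conj (mkCx a b) = mkCx a (-b) :=
  ext_parts (by simp) (by simp)

/-- `mkCx` is additive. [folklore] -/
theorem mkCx_add_mkCx (a b a' b' : ℝ ⊗[ℚ] V) : mkCx a b + mkCx a' b' = mkCx (a + a') (b + b') :=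
  ext_parts (by simp [map_add]) (by simp [map_add])

/-- `mkCx 0 0 = 0`. [folklore] -/
@[simp]
theorem mkCx_zero_zero : mkCx (0 : ℝ ⊗[ℚ] V) 0 = 0 := by
  simp [mkCx]

/-- `a + ib = 0 ↔ a = 0 ∧ b = 0`. [folklore] -/
theorem mkCx_eq_zero_iff {a b : ℝ ⊗[ℚ] V} : mkCx a b = 0 ↔ a = 0 ∧ b = 0 := by
  constructor
  · intro h
    exact ⟨by simpa using congrArg rePart h, by simpa using congrArg imPart h⟩
  · rintro ⟨rfl, rfl⟩
    exact mkCx_zero_zero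

/-! ### Rational bilinear forms on `V_ℂ` in terms of parts -/

/-- `Q_ℂ(a, a') = Q_ℝ(a, a')` for real vectors. [folklore] -/
theorem baseChange_ofRealT_ofRealT (Q : LinearMap.BilinForm ℚ V) (a a' : ℝ ⊗[ℚ] V) :
    Q.baseChange ℂ (ofRealT a) (ofRealT a') = ((Q.baseChange ℝ a a' : ℝ) : ℂ) := by
  induction a using TensorProduct.induction_on with
  | zero => simp
  | tmul r v =>
    induction a' using TensorProduct.induction_on with
    | zero => simp
    | tmul s w =>
      simp only [ofRealT_tmul, LinearMap.BilinForm.baseChange_tmul, Rat.smul_def]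
      push_cast
      ring
    | add x y hx hy => rw [map_add, map_add, map_add, hx, hy, Complex.ofReal_add]
  | add x y hx hy =>
    rw [map_add, map_add, LinearMap.add_apply, map_add, LinearMap.add_apply, hx, hy, Complex.ofReal_add]

/-- **`Q_ℂ(a + ib, a' + ib') = (Q(a, a') - Q(b, b')) + i (Q(a, b') + Q(b, a'))`.** [folklore] -/
theorem baseChange_mkCx_mkCx (Q : LinearMap.BilinForm ℚ V) (a b a' b' : ℝ ⊗[ℚ] V) :
    Q.baseChange ℂ (mkCx a b) (mkCx a' b') =
      ((Q.baseChange ℝ a a' - Q.baseChange ℝ b b' : ℝ) : ℂ) +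
        ((Q.baseChange ℝ a b' + Q.baseChange ℝ b a' : ℝ) : ℂ) * Complex.I := by
  simp only [mkCx, map_add, map_smul, LinearMap.add_apply, LinearMap.smul_apply, smul_eq_mul,
    baseChange_ofRealT_ofRealT]
  push_cast
  ring_nf
  rw [Complex.I_sq]
  ring

/-! ### The weight-one Hodge structure of a complex structure -/

section ComplexStructure

variable (J : ℝ ⊗[ℚ] V →ₗ[ℝ] ℝ ⊗[ℚ] V)

/-- **`V^{1,0}` of a complex structure `J` on `V_ℝ`**: the `-i`-eigenspace
`{x ∈ V_ℂ | J_ℂ x = -ix} = {a + iJa}` of the complexified `J`, written through real and imaginary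
parts (`im x = J re x`, `J im x = -re x`; the second equation follows from the first when `J² = -1`
and makes the carrier a complex subspace without that hypothesis). With the untwisted positivity
convention of `Motives/HodgeStructure.Polarization` and `Q = E` the Riemann form, this (and not the
`+i`-eigenspace) is the type-`(1,0)` part (`polarizationOfRiemannForm`). [cite: CarlsonMullerStachPeters2017, §3.5 eq. (3.5)]
[cite: vanGeemen1994HodgeAV, 3.1 and 5.7] -/
def cxF1 : Submodule ℂ (ℂ ⊗[ℚ] V) where
  carrier := {x | imPart x = J (rePart x) ∧ J (imPart x) = -rePart x}
  zero_mem' := by simp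
  add_mem' {x y} hx hy := by
    refine ⟨?_, ?_⟩
    · rw [map_add, map_add, map_add, hx.1, hy.1]
    · rw [map_add, map_add, map_add, hx.2, hy.2, neg_add]
  smul_mem' z x hx := by
    refine ⟨?_, ?_⟩
    · rw [imPart_smul, rePart_smul, map_sub, LinearMap.map_smul, LinearMap.map_smul, ← hx.1, hx.2,
        smul_neg, sub_neg_eq_add]
    · rw [imPart_smul, rePart_smul, map_add, LinearMap.map_smul, LinearMap.map_smul, hx.2, ← hx.1,
        smul_neg, neg_sub, sub_eq_neg_add]

/-- Membership in `cxF1 J`. [folklore] -/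
theorem mem_cxF1_iff {x : ℂ ⊗[ℚ] V} :
    x ∈ cxF1 J ↔ imPart x = J (rePart x) ∧ J (imPart x) = -rePart x := Iff.rfl

/-- Membership in `conj (cxF1 J)` (the `+i`-eigenspace `{a - iJa}`). [folklore] -/
theorem mem_complexConj_cxF1_iff {x : ℂ ⊗[ℚ] V} :
    x ∈ complexConj (cxF1 J) ↔ imPart x = -J (rePart x) ∧ J (imPart x) = rePart x := by
  rw [mem_complexConj, mem_cxF1_iff, rePart_conj, imPart_conj, map_neg, neg_eq_iff_eq_neg, neg_inj]

variable (hJ : ∀ a, J (J a) = -a)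
include hJ

/-- `a + iJa ∈ V^{1,0}`. [cite: vanGeemen1994HodgeAV, 5.7] -/
theorem mkCx_mem_cxF1 (a : ℝ ⊗[ℚ] V) : mkCx a (J a) ∈ cxF1 J :=
  ⟨by rw [imPart_mkCx, rePart_mkCx], by rw [imPart_mkCx, rePart_mkCx, hJ]⟩

/-- `a - iJa ∈ conj V^{1,0} = V^{0,1}`. [cite: vanGeemen1994HodgeAV, 5.7] -/
theorem mkCx_neg_mem_complexConj_cxF1 (a : ℝ ⊗[ℚ] V) : mkCx a (-J a) ∈ complexConj (cxF1 J) := by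
  rw [mem_complexConj_cxF1_iff, imPart_mkCx, rePart_mkCx, map_neg, hJ, neg_neg]
  exact ⟨rfl, rfl⟩

omit hJ in
/-- An element of `V^{1,0}` is `a + iJa` with `a` its real part. [cite: vanGeemen1994HodgeAV, 5.7] -/
theorem eq_mkCx_of_mem_cxF1 {x : ℂ ⊗[ℚ] V} (hx : x ∈ cxF1 J) : x = mkCx (rePart x) (J (rePart x)) :=
  ext_parts (by rw [rePart_mkCx]) (by rw [imPart_mkCx, hx.1])

omit hJ in
/-- An element of `V^{0,1}` is `a - iJa` with `a` its real part. [cite: vanGeemen1994HodgeAV, 5.7] -/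
theorem eq_mkCx_of_mem_complexConj_cxF1 {x : ℂ ⊗[ℚ] V} (hx : x ∈ complexConj (cxF1 J)) :
    x = mkCx (rePart x) (-J (rePart x)) :=
  ext_parts (by rw [rePart_mkCx]) (by rw [imPart_mkCx, ((mem_complexConj_cxF1_iff J).1 hx).1])

omit hJ in
/-- `a + iJa = 0 ↔ a = 0`. [folklore] -/
theorem mkCx_J_eq_zero_iff {a : ℝ ⊗[ℚ] V} : mkCx a (J a) = 0 ↔ a = 0 := by
  rw [mkCx_eq_zero_iff]
  exact ⟨fun h => h.1, fun h => ⟨h, by rw [h, map_zero]⟩⟩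

/-- **`V_ℂ = V^{1,0} ⊕ conj V^{1,0}`** for a complex structure `J` (`J² = -1`):
`x = ½((a - Jb) + iJ(a - Jb)) + ½((a + Jb) - iJ(a + Jb))` for `x = a + ib`.
[cite: CarlsonMullerStachPeters2017, §3.5 eq. (3.5)] [cite: vanGeemen1994HodgeAV, 5.7] -/
theorem isCompl_cxF1 : IsCompl (cxF1 J) (complexConj (cxF1 J)) := by
  refine ⟨?_, ?_⟩
  · rw [Submodule.disjoint_def]
    intro x hx hx'
    rw [mem_complexConj_cxF1_iff] at hx'
    have h1 : J (rePart x) = 0 := by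
      have h2 : (2 : ℝ) • J (rePart x) = 0 := by
        rw [two_smul]
        nth_rewrite 2 [← hx.1]
        rw [hx'.1, add_neg_cancel]
      exact (smul_eq_zero.1 h2).resolve_left two_ne_zero
    have hre : rePart x = 0 := by rw [← hx'.2, hx.1, h1, map_zero]
    have him : imPart x = 0 := by rw [hx.1, h1]
    exact ext_parts (by rw [hre, map_zero]) (by rw [him, map_zero])
  · rw [codisjoint_iff, eq_top_iff]
    intro x _
    set a := rePart x
    set b := imPart x
    have h1 : (2 : ℝ)⁻¹ • (a - J b) + (2 : ℝ)⁻¹ • (a + J b) = a := by module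
    have h2 : (2 : ℝ)⁻¹ • (a - J b) - (2 : ℝ)⁻¹ • (a + J b) = -J b := by module
    have hx : x = mkCx ((2 : ℝ)⁻¹ • (a - J b)) (J ((2 : ℝ)⁻¹ • (a - J b))) +
        mkCx ((2 : ℝ)⁻¹ • (a + J b)) (-J ((2 : ℝ)⁻¹ • (a + J b))) := by
      rw [mkCx_add_mkCx]
      refine ext_parts ?_ ?_
      · rw [rePart_mkCx, h1]
      · rw [imPart_mkCx, ← sub_eq_add_neg, ← map_sub, h2, map_neg, hJ, neg_neg]
    rw [hx]
    exact Submodule.add_mem_sup (mkCx_mem_cxF1 J hJ _) (mkCx_neg_mem_complexConj_cxF1 J hJ _)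

/-- **The weight-one `ℚ`-Hodge structure of the complex structure `J` on `V_ℝ`**
(`V^{1,0} = cxF1 J`, `V^{0,1} = conj V^{1,0}`). [cite: CarlsonMullerStachPeters2017, §3.5 eq. (3.5)]
[cite: vanGeemen1994HodgeAV, 3.1 and 5.7] -/
def hodgeStructureOfCx : HodgeStructure V 1 :=
  ofSplitting (cxF1 J) (isCompl_cxF1 J hJ) one_pos

/-- The Hodge filtration: `F^j = V_ℂ, V^{1,0}, 0` for `j ≤ 0`, `j = 1`, `j ≥ 2`. [folklore] -/
theorem hodgeStructureOfCx_F (j : ℤ) : (hodgeStructureOfCx J hJ).F j = twoStepFiltration (cxF1 J) 1 j :=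
  rfl

/-- `F¹ = V^{1,0} = cxF1 J`. [folklore] -/
theorem hodgeStructureOfCx_F_one : (hodgeStructureOfCx J hJ).F 1 = cxF1 J :=
  twoStepFiltration_of_pos_of_le _ one_pos le_rfl

/-- `V^{1,0} = cxF1 J`. [cite: CarlsonMullerStachPeters2017, §3.5 eq. (3.5)] -/
theorem piece_one_zero : (hodgeStructureOfCx J hJ).piece 1 0 = cxF1 J :=
  piece_ofSplitting_self_zero _ _ _

/-- `V^{0,1} = conj V^{1,0}`. [cite: CarlsonMullerStachPeters2017, §3.5 eq. (3.5)] -/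
theorem piece_zero_one : (hodgeStructureOfCx J hJ).piece 0 1 = complexConj (cxF1 J) :=
  piece_ofSplitting_zero_self _ _ _

/-- Only the types `(1,0)`, `(0,1)` occur. [folklore] -/
theorem piece_eq_bot {p q : ℤ} (h₁ : ¬(p = 1 ∧ q = 0)) (h₂ : ¬(p = 0 ∧ q = 1)) :
    (hodgeStructureOfCx J hJ).piece p q = ⊥ :=
  piece_ofSplitting_eq_bot _ _ _ h₁ h₂

/-- The Hodge structure of a complex structure is effective. [folklore] -/
theorem isEffective_hodgeStructureOfCx : (hodgeStructureOfCx J hJ).IsEffective := by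
  intro p q hne
  by_contra hpq
  exact hne (piece_eq_bot J hJ (by omega) (by omega))

/-- **`2 h^{1,0} = dim_ℚ V`** (`dim_ℂ V^{1,0} = dim_ℂ (V_ℝ, J) = ½ dim_ℝ V_ℝ`). [cite: CarlsonMullerStachPeters2017, §1.2] -/
theorem two_mul_hodgeNumber_hodgeStructureOfCx [Module.Finite ℚ V] :
    2 * (hodgeStructureOfCx J hJ).hodgeNumber 1 0 = finrank ℚ V :=
  two_mul_hodgeNumber_ofSplitting _ _ _

/-- `2 dim_ℂ V^{1,0} = dim_ℚ V`. [cite: CarlsonMullerStachPeters2017, §1.2] -/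
theorem two_mul_finrank_cxF1 [Module.Finite ℚ V] : 2 * finrank ℂ (cxF1 J) = finrank ℚ V := by
  rw [← piece_one_zero J hJ]
  exact two_mul_hodgeNumber_ofSplitting _ _ _

/-! ### Riemann forms polarize -/

omit hJ in
/-- The real extension of an alternating form is alternating. [folklore] -/
theorem baseChange_real_swap (E : LinearMap.BilinForm ℚ V) (hE : ∀ x y, E y x = -E x y)
    (a b : ℝ ⊗[ℚ] V) : E.baseChange ℝ b a = -E.baseChange ℝ a b := by
  induction a using TensorProduct.induction_on generalizing b with
  | zero => simp
  | tmul r v =>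
    induction b using TensorProduct.induction_on with
    | zero => simp
    | tmul s w =>
      rw [LinearMap.BilinForm.baseChange_tmul, LinearMap.BilinForm.baseChange_tmul, hE, neg_smul,
        mul_comm]
    | add x y hx hy => rw [map_add, LinearMap.add_apply, map_add, hx, hy, neg_add]
  | add x y hx hy => rw [map_add, map_add, LinearMap.add_apply, hx, hy, neg_add]

omit hJ in
/-- `E_ℝ(a, a) = 0` for an alternating `E`. [folklore] -/
theorem baseChange_real_self (E : LinearMap.BilinForm ℚ V) (hE : ∀ x y, E y x = -E x y)
    (a : ℝ ⊗[ℚ] V) : E.baseChange ℝ a a = 0 := by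
  have h := baseChange_real_swap E hE a a
  linarith

/-- **First Riemann relation ⟹ `V^{1,0}` is isotropic**: `E_ℂ(a + iJa, a' + iJa') = 0` when
`E(Jx, Jy) = E(x, y)`. [cite: vanGeemen1994HodgeAV, 5.6] [cite: Deligne1982HodgeCycles, proof of Thm. 4.8, p. 47 (b)] -/
theorem baseChange_eq_zero_of_mem_cxF1 (E : LinearMap.BilinForm ℚ V)
    (hEJ : ∀ a b, E.baseChange ℝ (J a) (J b) = E.baseChange ℝ a b) {x y : ℂ ⊗[ℚ] V}
    (hx : x ∈ cxF1 J) (hy : y ∈ cxF1 J) : E.baseChange ℂ x y = 0 := by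
  rw [eq_mkCx_of_mem_cxF1 J hx, eq_mkCx_of_mem_cxF1 J hy, baseChange_mkCx_mkCx, hEJ]
  have h : E.baseChange ℝ (J (rePart x)) (rePart y) = -E.baseChange ℝ (rePart x) (J (rePart y)) := by
    rw [← hEJ (J (rePart x)) (rePart y), hJ, map_neg, LinearMap.neg_apply]
  rw [h, sub_self, add_neg_cancel]
  simp

omit hJ in
/-- `E_ℂ(a + iJa, conj(a + iJa)) = -2i E(a, Ja)`. [cite: vanGeemen1994HodgeAV, 5.6] -/
theorem baseChange_mkCx_conj (E : LinearMap.BilinForm ℚ V) (hE : ∀ x y, E y x = -E x y)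
    (a : ℝ ⊗[ℚ] V) :
    E.baseChange ℂ (mkCx a (J a)) (conj (mkCx a (J a))) =
      -(2 * ((E.baseChange ℝ a (J a) : ℝ) : ℂ)) * Complex.I := by
  rw [conj_mkCx, baseChange_mkCx_mkCx, map_neg, map_neg, baseChange_real_self E hE,
    baseChange_real_self E hE, baseChange_real_swap E hE a (J a)]
  push_cast
  ring

omit hJ in
/-- `E_ℂ(a - iJa, conj(a - iJa)) = 2i E(a, Ja)`. [cite: vanGeemen1994HodgeAV, 5.6] -/
theorem baseChange_mkCx_neg_conj (E : LinearMap.BilinForm ℚ V) (hE : ∀ x y, E y x = -E x y)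
    (a : ℝ ⊗[ℚ] V) :
    E.baseChange ℂ (mkCx a (-J a)) (conj (mkCx a (-J a))) =
      (2 * ((E.baseChange ℝ a (J a) : ℝ) : ℂ)) * Complex.I := by
  rw [conj_mkCx, neg_neg, baseChange_mkCx_mkCx, map_neg, LinearMap.neg_apply, LinearMap.neg_apply,
    baseChange_real_self E hE, baseChange_real_self E hE, baseChange_real_swap E hE a (J a)]
  push_cast
  ring

/-- **Riemann relations ⟹ polarization** (van Geemen 5.6; Deligne p. 47 (b)): an alternating form
`E` on `V` with `E(Jx, Jy) = E(x, y)` and `E(x, Jx) > 0` for `x ≠ 0` on `V_ℝ` is a polarization of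
the weight-one Hodge structure of `J` (untwisted convention `i^{p-q} E_ℂ(x, conj x) > 0`: on
`V^{1,0} ∋ x = a + iJa` this is `i · (-2i E(a, Ja)) = 2E(a, Ja)`). [cite: vanGeemen1994HodgeAV, 5.6]
[cite: Deligne1982HodgeCycles, proof of Thm. 4.8, p. 47 (b)] [cite: CarlsonMullerStachPeters2017, §3.5] -/
def polarizationOfRiemannForm (E : LinearMap.BilinForm ℚ V) (hE : ∀ x y, E y x = -E x y)
    (hEJ : ∀ a b, E.baseChange ℝ (J a) (J b) = E.baseChange ℝ a b)
    (hpos : ∀ a, a ≠ 0 → 0 < E.baseChange ℝ a (J a)) : (hodgeStructureOfCx J hJ).Polarization where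
  form := E
  flip_form := by
    ext x y
    change E y x = ((((1 : ℤ).negOnePow : ℤˣ) : ℤ) • E) x y
    rw [hE, Int.negOnePow_one, Units.val_neg, Units.val_one, LinearMap.smul_apply,
      LinearMap.smul_apply, neg_smul, one_smul]
  form_apply_eq_zero j x hx y hy := by
    rw [hodgeStructureOfCx_F] at hx hy
    by_cases hj : j ≤ 0
    · rw [twoStepFiltration_of_lt (cxF1 J) (by omega) (by omega), Submodule.mem_bot] at hy
      rw [hy, map_zero]
    by_cases hj1 : 1 < j
    · rw [twoStepFiltration_of_lt (cxF1 J) (not_le.1 hj) hj1, Submodule.mem_bot] at hx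
      rw [hx, map_zero, LinearMap.zero_apply]
    obtain rfl : j = 1 := by omega
    rw [twoStepFiltration_of_pos_of_le (cxF1 J) one_pos le_rfl] at hx
    rw [show (1 : ℤ) + 1 - 1 = 1 by norm_num, twoStepFiltration_of_pos_of_le (cxF1 J) one_pos le_rfl] at hy
    exact baseChange_eq_zero_of_mem_cxF1 J hJ E hEJ hx hy
  pos p q hpq x hx hx0 := by
    by_cases h₁ : p = 1 ∧ q = 0
    · obtain ⟨rfl, rfl⟩ := h₁
      rw [piece_one_zero] at hx
      have ha : rePart x ≠ 0 := fun h => hx0 (by rw [eq_mkCx_of_mem_cxF1 J hx, h, map_zero, mkCx_zero_zero])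
      refine ⟨2 * E.baseChange ℝ (rePart x) (J (rePart x)), by linarith [hpos _ ha], ?_⟩
      rw [eq_mkCx_of_mem_cxF1 J hx, baseChange_mkCx_conj J E hE]
      rw [rePart_mkCx, zpow_one, zpow_zero, inv_one, mul_one]
      push_cast
      ring_nf
      rw [Complex.I_sq]
      ring
    by_cases h₂ : p = 0 ∧ q = 1
    · obtain ⟨rfl, rfl⟩ := h₂
      rw [piece_zero_one] at hx
      have ha : rePart x ≠ 0 := fun h =>
        hx0 (by rw [eq_mkCx_of_mem_complexConj_cxF1 J hx, h, map_zero, neg_zero, mkCx_zero_zero])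
      refine ⟨2 * E.baseChange ℝ (rePart x) (J (rePart x)), by linarith [hpos _ ha], ?_⟩
      rw [eq_mkCx_of_mem_complexConj_cxF1 J hx, baseChange_mkCx_neg_conj J E hE]
      rw [rePart_mkCx, zpow_one, zpow_zero, one_mul, Complex.inv_I]
      push_cast
      ring_nf
      rw [Complex.I_sq]
      ring
    · rw [piece_eq_bot J hJ h₁ h₂, Submodule.mem_bot] at hx
      exact (hx0 hx).elim

/-- The form of `polarizationOfRiemannForm` is `E`. [folklore] -/
@[simp]
theorem polarizationOfRiemannForm_form (E : LinearMap.BilinForm ℚ V) (hE : ∀ x y, E y x = -E x y)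
    (hEJ : ∀ a b, E.baseChange ℝ (J a) (J b) = E.baseChange ℝ a b)
    (hpos : ∀ a, a ≠ 0 → 0 < E.baseChange ℝ a (J a)) :
    (polarizationOfRiemannForm J hJ E hE hEJ hpos).form = E :=
  rfl

/-- **The Hodge structure of a complex structure with a Riemann form is polarizable** (so that,
after uniformisation, `V_ℝ/Λ` is an abelian variety). [cite: vanGeemen1994HodgeAV, 5.6–5.7]
[cite: CarlsonMullerStachPeters2017, §3.5] -/
theorem isPolarizable_hodgeStructureOfCx (E : LinearMap.BilinForm ℚ V) (hE : ∀ x y, E y x = -E x y)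
    (hEJ : ∀ a b, E.baseChange ℝ (J a) (J b) = E.baseChange ℝ a b)
    (hpos : ∀ a, a ≠ 0 → 0 < E.baseChange ℝ a (J a)) : (hodgeStructureOfCx J hJ).IsPolarizable :=
  ⟨polarizationOfRiemannForm J hJ E hE hEJ hpos⟩

end ComplexStructure

end HodgeStructure

end Literature.AlgebraicGeometry.Motives

end
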